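import Summits.CriticalPhenomena.PercolationContinuityZ3.Theorems.PercNearOneGluingNoHeavyLowerTailSahiGridPatternOrthantHarrisLifts
import Summits.CriticalPhenomena.PercolationContinuityZ3.Theorems.PercNearOneGluingNoHeavyLowerTailSahiGridPatternBlockProduct
import Summits.CriticalPhenomena.PercolationContinuityZ3.Theorems.PercNearOneGluingNoHeavyLowerTailSahiGridPatternRectCert

/-!
# `NoHeavyLowerTail` (crux stmt-CriticalPhenomena-4575), Sahi programme P1: **THE ORTHANT SLOT DOMINATES ITS HARRIS SLACK,
# EVERY DIMENSION** — `sStarD (↑p) B C ≥ 2^d·#(↑p∩B∩C) − N(↑p; B∩C)` for every principal up-set `↑p ⊆ [3]^d` and all up-sets `B, C`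

Support file (Sahi cell, seat `prim-sahi-p1`, generation 18; `--supports stmt-CriticalPhenomena-4575`).  Pure proofs, NO definitions,
no `sorry`, standard axioms.  Vocabulary of `…SahiGridPattern{,Harris,Kleitman,Orthant,AllDim,BlockProduct,RectCert,OrthantHarrisLifts}`.

THE MATHEMATICS.  `N(X;Y) = #{(x,y) ∈ X×Y : x δ̸ y}` (totally distinct pairs), `H(X,Y) = 2^d·#(X∩Y) − N(X;Y) ≥ 0` the coefficientwise
Harris slack of two up-sets (`tdPairs_le_card_inter`).  In counting form `sStarD A B C = M + H(A,B∩C) + H(B,A∩C) + H(C,A∩B) − 2^d·#(ABC)`.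
**THEOREM (`sStarD_principal_ge_harris`, every `d`)**: for every `p ∈ [3]^d` and all up-sets `B, C ⊆ [3]^d`,
  `2^d · #(↑p ∩ B ∩ C) ≤ sStarD (↑p) B C + N(↑p; B∩C)`,   i.e.   `H(↑p, B∩C) ≤ sStarD (↑p) B C`,
equivalently `M(↑p,B,C) + H(B, ↑p∩C) + H(C, ↑p∩B) ≥ 2^d·#(↑p∩B∩C)`.  This SHARPENS the orthant theorem `0 ≤ sStarD (↑p) B C`
(`sStarD_principal_nonneg`, generation 9) by the nonnegative slack `H(↑p,B∩C)`; equality holds e.g. for `B = C = ⊤`.  It was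
generation 16's CONJECTURE P (census: exhaustive for `k ≤ 4`; here proved for all `d`): in the language of `…DiagCert`, condition (N)
`Θ_U(A×A′) ≤ 2^k·#(A∩A′∩U)` holds for the TRIVIAL diagonal certificate `d = 2^k·1_U` of every principal `U`, in every `k`
(a reformulation not restated here).  Proof: the orthant induction of `sStarD_principal_nonneg` run with the sharper functional
`G(U;B,C) = sStarD U B C − H(U,B∩C)`: the two instance-blind lifts hold for `G` (`liftTwo_harris`, `topOnly_harris`), `G` is invariant
under axis symmetries (`harrisGood_perm`), and on the whole-cube face `G(⊤;B,C) = sStarD ⊤ B C ≥ 0` (`harrisGood_univ`, as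
`N(⊤;Y) = 2^d·#Y`).  Counting and slack forms: `sStarD_principal_ge_harris_card`, `harrisSlack_le_sStarD_principal`; certificate form
`diagCert_N_of_principal` (condition (N) of `…DiagCert` for the trivial `d = 2^k·1_{↑p}`).
Nothing here asserts `PatternPos d` for any `d ≥ 4`. [this work]
-/

namespace Summit.CriticalPhenomena.PercolationContinuityZ3.Theorems.SahiGridPattern

open Finset SahiGrid3
open scoped BigOperators

variable {n : ℕ}

/-! ### Transfer along axis symmetries, the whole-cube face, the inductive step -/

/-- Total distinctness is invariant under a simultaneous axis permutation. [this work] -/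
theorem totDist_comp_perm {d : ℕ} (τ : Equiv.Perm (Fin d)) (x y : Pd d) : TotDist (x ∘ τ) (y ∘ τ) = TotDist x y := by
  have key : (∀ a, (x ∘ τ) a ≠ (y ∘ τ) a) ↔ (∀ a, x a ≠ y a) :=
    ⟨fun h a => by simpa using h (τ.symm a), fun h a => h (τ a)⟩
  unfold TotDist
  by_cases hc : ∀ a, x a ≠ y a
  · rw [decide_eq_true (key.2 hc), decide_eq_true hc]
  · rw [decide_eq_false (fun h => hc (key.1 h)), decide_eq_false hc]

/-- Indicator of the image under an axis symmetry. [this work] -/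
theorem ind_map_compEquivD {d : ℕ} (τ : Equiv.Perm (Fin d)) (S : Finset (Pd d)) (x : Pd d) :
    ind (S.map (compEquivD τ).toEmbedding) ((compEquivD τ) x) = ind S x := by
  unfold ind; simp only [Finset.mem_map_equiv, Equiv.symm_apply_apply]

/-- **Transfer of the Harris-sharpened orthant property along an axis symmetry**: if `x ∈ A' ↔ x ∘ τ ∈ A` and `A` satisfies
`2^d·#(A∩B∩C) ≤ sStarD A B C + N(A;B∩C)` for all up-sets `B, C`, so does `A'`. [this work] -/
theorem harrisGood_perm {d : ℕ} (τ : Equiv.Perm (Fin d)) {A A' : Finset (Pd d)}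
    (hA : ∀ B C : Finset (Pd d), IsUpperSet (B : Set (Pd d)) → IsUpperSet (C : Set (Pd d)) →
      2 ^ d * (∑ x, ind A x * ind B x * ind C x) ≤
        sStarD A B C + ∑ x, ∑ y, ind A x * ind B y * ind C y * (if TotDist x y = true then (1:ℤ) else 0))
    (h : ∀ x, x ∈ A' ↔ x ∘ τ ∈ A) :
    ∀ B C : Finset (Pd d), IsUpperSet (B : Set (Pd d)) → IsUpperSet (C : Set (Pd d)) →
      2 ^ d * (∑ x, ind A' x * ind B x * ind C x) ≤
        sStarD A' B C + ∑ x, ∑ y, ind A' x * ind B y * ind C y * (if TotDist x y = true then (1:ℤ) else 0) := by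
  intro B' C' hB' hC'
  let e : Pd d ≃ Pd d := compEquivD τ
  have hA' : ∀ x, ind A' x = ind A (e x) := fun x => by
    unfold ind; simp only [h x]; rfl
  have hBm : ∀ x, ind B' x = ind (B'.map e.toEmbedding) (e x) := fun x => (ind_map_compEquivD τ B' x).symm
  have hCm : ∀ x, ind C' x = ind (C'.map e.toEmbedding) (e x) := fun x => (ind_map_compEquivD τ C' x).symm
  have htd : ∀ x y, TotDist (e x) (e y) = TotDist x y := fun x y => totDist_comp_perm τ x y
  have e1 : sStarD A' B' C' = sStarD A (B'.map e.toEmbedding) (C'.map e.toEmbedding) := by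
    rw [sStarD_eq_sum_tcD, sStarD_eq_sum_tcD]
    refine Finset.sum_equiv e (fun p => ?_) fun p _ => ?_
    · rw [h p]; rfl
    · refine Finset.sum_equiv e (fun q => ?_) fun q _ => ?_
      · rw [Finset.mem_map_equiv, Equiv.symm_apply_apply]
      · refine Finset.sum_equiv e (fun r => ?_) fun r _ => ?_
        · rw [Finset.mem_map_equiv, Equiv.symm_apply_apply]
        · exact (tcD_perm τ p q r).symm
  have e2 : (∑ x, ind A' x * ind B' x * ind C' x) =
      ∑ x, ind A x * ind (B'.map e.toEmbedding) x * ind (C'.map e.toEmbedding) x := by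
    refine Fintype.sum_equiv e _ _ fun x => ?_
    rw [hA', hBm, hCm]
  have e3 : (∑ x, ∑ y, ind A' x * ind B' y * ind C' y * (if TotDist x y = true then (1:ℤ) else 0)) =
      ∑ x, ∑ y, ind A x * ind (B'.map e.toEmbedding) y * ind (C'.map e.toEmbedding) y * (if TotDist x y = true then (1:ℤ) else 0) := by
    refine Fintype.sum_equiv e _ _ fun x => ?_
    refine Fintype.sum_equiv e _ _ fun y => ?_
    rw [hA', hBm, hCm, htd]
  rw [e1, e2, e3]
  exact hA _ _ (isUpperSet_map_compEquivD τ hB') (isUpperSet_map_compEquivD τ hC')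

/-- **The whole-cube face**: `2^d·#(B∩C) ≤ sStarD ⊤ B C + N(⊤;B∩C)` (indeed `N(⊤;Y) = 2^d·#Y` and `sStarD ⊤ B C ≥ 0`). [this work] -/
theorem harrisGood_univ {d : ℕ} (B C : Finset (Pd d)) (hB : IsUpperSet (B : Set (Pd d))) (hC : IsUpperSet (C : Set (Pd d))) :
    2 ^ d * (∑ x, ind (univ : Finset (Pd d)) x * ind B x * ind C x) ≤
      sStarD univ B C + ∑ x, ∑ y, ind (univ : Finset (Pd d)) x * ind B y * ind C y * (if TotDist x y = true then (1:ℤ) else 0) := by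
  have h1 : ∀ x, ind (univ : Finset (Pd d)) x = 1 := fun x => by unfold ind; rw [if_pos (Finset.mem_univ x)]
  simp only [h1, one_mul]
  have h2 : (∑ x : Pd d, ∑ y : Pd d, ind B y * ind C y * (if TotDist x y = true then (1:ℤ) else 0)) =
      2 ^ d * ∑ y, ind B y * ind C y := by
    rw [Finset.sum_comm, Finset.mul_sum]
    refine Finset.sum_congr rfl fun y _ => ?_
    have h3 : (∑ x : Pd d, (if TotDist x y = true then (1:ℤ) else 0)) = 2 ^ d := by
      rw [show (∑ x : Pd d, (if TotDist x y = true then (1:ℤ) else 0)) = ∑ x : Pd d, (if TotDist y x = true then (1:ℤ) else 0) from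
        Finset.sum_congr rfl fun x _ => by rw [totDist_symm]]
      exact sum_ite_totDist_eq_two_pow y
    rw [show (∑ x : Pd d, ind B y * ind C y * (if TotDist x y = true then (1:ℤ) else 0)) =
      ind B y * ind C y * ∑ x : Pd d, (if TotDist x y = true then (1:ℤ) else 0) from (Finset.mul_sum _ _ _).symm, h3]
    ring
  rw [h2]
  linarith [sStarD_nonneg_of_eq_univ₁ (d := d) hB hC]

/-- The inductive step: a principal filter whose LAST threshold is nonzero, given the sharpened orthant theorem one dimension down. [this work] -/
theorem harrisGood_filter_le_step
    (ih : ∀ (p' : Pd n) (B C : Finset (Pd n)), IsUpperSet (B : Set (Pd n)) → IsUpperSet (C : Set (Pd n)) →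
      2 ^ n * (∑ x, ind (univ.filter fun x : Pd n => ∀ b, p' b ≤ x b) x * ind B x * ind C x) ≤
        sStarD (univ.filter fun x : Pd n => ∀ b, p' b ≤ x b) B C
          + ∑ x, ∑ y, ind (univ.filter fun x : Pd n => ∀ b, p' b ≤ x b) x * ind B y * ind C y * (if TotDist x y = true then (1:ℤ) else 0))
    (q : Pd (n + 1)) (hq : q (Fin.last n) ≠ 0) (B C : Finset (Pd (n + 1)))
    (hB : IsUpperSet (B : Set (Pd (n + 1)))) (hC : IsUpperSet (C : Set (Pd (n + 1)))) :
    2 ^ (n + 1) * (∑ x, ind (univ.filter fun x : Pd (n + 1) => ∀ a, q a ≤ x a) x * ind B x * ind C x) ≤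
      sStarD (univ.filter fun x : Pd (n + 1) => ∀ a, q a ≤ x a) B C
        + ∑ x, ∑ y, ind (univ.filter fun x : Pd (n + 1) => ∀ a, q a ≤ x a) x * ind B y * ind C y *
            (if TotDist x y = true then (1:ℤ) else 0) := by
  set A : Finset (Pd (n + 1)) := univ.filter fun x : Pd (n + 1) => ∀ a, q a ≤ x a with hAdef
  have hA : IsUpperSet (A : Set (Pd (n + 1))) := by rw [hAdef]; exact isUpperSet_filter_le q
  set p' : Pd n := fun b => q (Fin.castSucc b) with hp'def
  have memA : ∀ (x : Pd n) (l : Fin 3), (Fin.snoc x l : Pd (n + 1)) ∈ A ↔ ((∀ b, p' b ≤ x b) ∧ q (Fin.last n) ≤ l) := by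
    intro x l; rw [hAdef, Finset.mem_filter, le_snoc_iff]; simp [hp'def]
  have hA0 : ∀ x : Pd n, (Fin.snoc x 0 : Pd (n + 1)) ∉ A := by
    intro x h; rw [memA] at h
    exact hq (le_antisymm h.2 (Fin.zero_le _))
  have topA : (univ.filter fun x : Pd n => (Fin.snoc x 2 : Pd (n + 1)) ∈ A) = univ.filter fun x : Pd n => ∀ b, p' b ≤ x b := by
    ext x; simp only [Finset.mem_filter, Finset.mem_univ, true_and, memA]
    have l2 : ∀ i : Fin 3, i ≤ 2 := by decide
    constructor
    · exact fun h => h.1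
    · intro h; exact ⟨h, l2 _⟩
  have hcases : q (Fin.last n) = 1 ∨ q (Fin.last n) = 2 := by
    have key : ∀ i : Fin 3, i ≠ 0 → i = 1 ∨ i = 2 := by decide
    exact key _ hq
  have hB1 := isUpperSet_filter_snoc hB 1
  have hB2 := isUpperSet_filter_snoc hB 2
  have hC1 := isUpperSet_filter_snoc hC 1
  have hC2 := isUpperSet_filter_snoc hC 2
  have hpow : (2:ℤ) ^ (n + 1) = 2 * 2 ^ n := by ring
  rw [hpow]
  rcases hcases with h1 | h2
  · -- two-level lift
    have hA12 : ∀ x : Pd n, (Fin.snoc x 1 : Pd (n + 1)) ∈ A ↔ (Fin.snoc x 2 : Pd (n + 1)) ∈ A := by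
      intro x; rw [memA, memA, h1]; simp
    have L := liftTwo_harris A B C hA hB hC hA0 hA12
    have h12ne : (1 : Fin 3) ≠ 2 := by decide
    simp only [Finset.sum_pair h12ne] at L
    rw [topA] at L
    have i11 := ih p' _ _ hB1 hC1
    have i12 := ih p' _ _ hB1 hC2
    have i21 := ih p' _ _ hB2 hC1
    have i22 := ih p' _ _ hB2 hC2
    linarith
  · -- top-only lift
    have hA1 : ∀ x : Pd n, (Fin.snoc x 1 : Pd (n + 1)) ∉ A := by
      intro x h; rw [memA, h2] at h
      exact absurd h.2 (by decide : ¬ ((2:Fin 3) ≤ 1))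
    have L := topOnly_harris A B C hA hB hC hA0 hA1
    rw [topA] at L
    have i22 := ih p' _ _ hB2 hC2
    linarith

/-! ### The theorem -/

/-- **THE ORTHANT SLOT, HARRIS-SHARPENED, EVERY DIMENSION** (generation 16's CONJECTURE P): for every `d`, every `p ∈ [3]^d` and all
up-sets `B, C ⊆ [3]^d`,  `2^d · #(↑p ∩ B ∩ C) ≤ sStarD (↑p) B C + N(↑p; B ∩ C)`, i.e.
`sStarD (↑p) B C ≥ H(↑p, B∩C) = 2^d·#(↑p∩B∩C) − N(↑p;B∩C) ≥ 0` — the pattern functional with an orthant slot dominates the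
(coefficientwise) Harris slack of the orthant against the intersection of the other two sets.  Sharpens `sStarD_principal_nonneg`;
equality is attained (e.g. `B = C = ⊤`).  Proof: the orthant induction with the Harris-sharpened lifts. [this work] -/
theorem sStarD_principal_ge_harris : ∀ (d : ℕ) (p : Pd d) (B C : Finset (Pd d)),
    IsUpperSet (B : Set (Pd d)) → IsUpperSet (C : Set (Pd d)) →
    2 ^ d * (∑ x, ind (univ.filter fun x : Pd d => ∀ a, p a ≤ x a) x * ind B x * ind C x) ≤
      sStarD (univ.filter fun x : Pd d => ∀ a, p a ≤ x a) B C
        + ∑ x, ∑ y, ind (univ.filter fun x : Pd d => ∀ a, p a ≤ x a) x * ind B y * ind C y *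
            (if TotDist x y = true then (1:ℤ) else 0) := by
  intro d
  induction d with
  | zero =>
    intro p B C hB hC
    have e : (univ.filter fun x : Pd 0 => ∀ a, p a ≤ x a) = univ := by
      ext x; simp only [Finset.mem_filter, Finset.mem_univ, true_and, iff_true]
      exact fun a => Fin.elim0 a
    rw [e]; exact harrisGood_univ B C hB hC
  | succ n ih =>
    intro p B C hB hC
    by_cases hz : ∃ a, p a ≠ 0
    · obtain ⟨a, ha⟩ := hz
      let τ : Equiv.Perm (Fin (n + 1)) := Equiv.swap a (Fin.last n)
      have hq : (p ∘ τ) (Fin.last n) ≠ 0 := by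
        show p (τ (Fin.last n)) ≠ 0
        rw [Equiv.swap_apply_right]; exact ha
      have step : ∀ B' C' : Finset (Pd (n + 1)), IsUpperSet (B' : Set (Pd (n + 1))) → IsUpperSet (C' : Set (Pd (n + 1))) →
          2 ^ (n + 1) * (∑ x, ind (univ.filter fun x : Pd (n + 1) => ∀ a, (p ∘ τ) a ≤ x a) x * ind B' x * ind C' x) ≤
            sStarD (univ.filter fun x : Pd (n + 1) => ∀ a, (p ∘ τ) a ≤ x a) B' C'
              + ∑ x, ∑ y, ind (univ.filter fun x : Pd (n + 1) => ∀ a, (p ∘ τ) a ≤ x a) x * ind B' y * ind C' y *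
                  (if TotDist x y = true then (1:ℤ) else 0) :=
        fun B' C' hB' hC' => harrisGood_filter_le_step ih (p ∘ τ) hq B' C' hB' hC'
      have hmem : ∀ x : Pd (n + 1), x ∈ (univ.filter fun x : Pd (n + 1) => ∀ a, p a ≤ x a) ↔
          x ∘ τ ∈ (univ.filter fun x : Pd (n + 1) => ∀ a, (p ∘ τ) a ≤ x a) := by
        intro x
        simp only [Finset.mem_filter, Finset.mem_univ, true_and, Function.comp_apply]
        constructor
        · intro h b; exact h (τ b)
        · intro h b
          have := h (τ.symm b)
          simpa using this
      exact harrisGood_perm τ step hmem B C hB hC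
    · simp only [not_exists, not_not] at hz
      have e : (univ.filter fun x : Pd (n + 1) => ∀ a, p a ≤ x a) = univ := by
        ext x; simp only [Finset.mem_filter, Finset.mem_univ, true_and, iff_true]
        intro a; rw [hz a]; exact Fin.zero_le _
      rw [e]; exact harrisGood_univ B C hB hC

/-- **Counting form**: `2^d·#(↑p ∩ B ∩ C) ≤ sStarD (↑p) B C + #{(x,y) ∈ ↑p × (B ∩ C) : x δ̸ y}`. [this work] -/
theorem sStarD_principal_ge_harris_card {d : ℕ} (p : Pd d) {B C : Finset (Pd d)}
    (hB : IsUpperSet (B : Set (Pd d))) (hC : IsUpperSet (C : Set (Pd d))) :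
    2 ^ d * (((univ.filter fun x : Pd d => ∀ a, p a ≤ x a) ∩ (B ∩ C)).card : ℤ) ≤
      sStarD (univ.filter fun x : Pd d => ∀ a, p a ≤ x a) B C
        + ((((univ.filter fun x : Pd d => ∀ a, p a ≤ x a) ×ˢ (B ∩ C)).filter fun xy => TotDist xy.1 xy.2 = true).card : ℤ) := by
  have h := sStarD_principal_ge_harris d p B C hB hC
  have hBC : ∀ y, ind B y * ind C y = ind (B ∩ C) y := fun y => (ind_inter_eq_mul B C y).symm
  have e1 : (∑ x, ind (univ.filter fun x : Pd d => ∀ a, p a ≤ x a) x * ind B x * ind C x) =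
      (((univ.filter fun x : Pd d => ∀ a, p a ≤ x a) ∩ (B ∩ C)).card : ℤ) := by
    rw [← sum_ind_mul_ind_eq_card]
    exact Finset.sum_congr rfl fun x _ => by rw [mul_assoc, hBC]
  have e2 : (∑ x, ∑ y, ind (univ.filter fun x : Pd d => ∀ a, p a ≤ x a) x * ind B y * ind C y *
      (if TotDist x y = true then (1:ℤ) else 0)) =
      ((((univ.filter fun x : Pd d => ∀ a, p a ≤ x a) ×ˢ (B ∩ C)).filter fun xy => TotDist xy.1 xy.2 = true).card : ℤ) := by
    rw [← sum_sum_ind_totDist_eq_card]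
    exact Finset.sum_congr rfl fun x _ => Finset.sum_congr rfl fun y _ => by rw [mul_assoc (ind _ x), hBC]
  rw [← e1, ← e2]; exact h

/-- **Equivalent form with the Harris slack made explicit**: `H(↑p, B∩C) ≤ sStarD (↑p) B C` where
`H(X,Y) = 2^d·#(X∩Y) − #{td pairs in X × Y} ≥ 0` (`tdPairs_le_card_inter`); so the orthant slot theorem `0 ≤ sStarD (↑p) B C` is
recovered with the nonnegative slack `H(↑p, B∩C)` to spare. [this work] -/
theorem harrisSlack_le_sStarD_principal {d : ℕ} (p : Pd d) {B C : Finset (Pd d)}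
    (hB : IsUpperSet (B : Set (Pd d))) (hC : IsUpperSet (C : Set (Pd d))) :
    2 ^ d * (((univ.filter fun x : Pd d => ∀ a, p a ≤ x a) ∩ (B ∩ C)).card : ℤ)
      - ((((univ.filter fun x : Pd d => ∀ a, p a ≤ x a) ×ˢ (B ∩ C)).filter fun xy => TotDist xy.1 xy.2 = true).card : ℤ)
      ≤ sStarD (univ.filter fun x : Pd d => ∀ a, p a ≤ x a) B C := by
  linarith [sStarD_principal_ge_harris_card p hB hC]


/-! ### The trivial diagonal certificate of a principal slot: condition (N) of `…DiagCert` -/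

/-- **Condition (N) for the TRIVIAL diagonal certificate `d = 2^k·1_U` of a PRINCIPAL up-set `U = ↑p`, every `k`**:
`Θ_U(A×A′) = Σ_{q∈A} Σ_{r∈A′} Θ_U(q,r) ≤ Σ_{q ∈ A∩A′} 2^k·1_U(q) = 2^k·#(A∩A′∩U)` for all up-sets `A, A′` — generation 16's CONJECTURE P in
the certificate language (with `diagCert_T_of_trivial` this makes `d = 2^k·1_{↑p}` a diagonal certificate for every principal slot, so
`sStarD_cylSet_nonneg_of_diagCert` re-proves the orthant slot in every dimension by certificate).  From `sStarD_principal_ge_harris` and the slice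
form `sStarD U A A′ = Σ_{A∩A′} λ_U − Θ_U(A×A′)`. [this work] -/
theorem diagCert_N_of_principal {k : ℕ} (p : Pd k) (A A' : Finset (Pd k))
    (hA : IsUpperSet (A : Set (Pd k))) (hA' : IsUpperSet (A' : Set (Pd k))) :
    (∑ q ∈ A, ∑ r ∈ A', thetaVal (univ.filter fun x : Pd k => ∀ a, p a ≤ x a) q r) ≤
      ∑ q ∈ A ∩ A', (2 : ℤ) ^ k * ind (univ.filter fun x : Pd k => ∀ a, p a ≤ x a) q := by
  set U : Finset (Pd k) := univ.filter fun x : Pd k => ∀ a, p a ≤ x a with hUdef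
  have hS := sStarD_eq_sum_lamU_sub_sum_thetaVal U A A'
  have h := sStarD_principal_ge_harris_card p hA hA'
  rw [← hUdef] at h
  have hnu : (∑ q ∈ A ∩ A', (nuCount U q : ℤ)) = (((U ×ˢ (A ∩ A')).filter fun pq => TotDist pq.1 pq.2 = true).card : ℤ) := by
    unfold nuCount
    rw [Finset.card_filter, Nat.cast_sum, Finset.sum_product, Finset.sum_comm]
    refine Finset.sum_congr rfl fun q _ => ?_
    rw [Finset.card_filter, Nat.cast_sum]
  have hind : (∑ q ∈ A ∩ A', ind U q) = ((U ∩ (A ∩ A')).card : ℤ) := by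
    unfold ind
    rw [Finset.sum_boole, Finset.filter_mem_eq_inter, Finset.inter_comm]
  have hlam : (∑ q ∈ A ∩ A', lamU U q) = 2 * 2 ^ k * (∑ q ∈ A ∩ A', ind U q) - ∑ q ∈ A ∩ A', (nuCount U q : ℤ) := by
    unfold lamU
    rw [Finset.sum_sub_distrib, ← Finset.mul_sum]
  rw [← Finset.mul_sum, hind]
  rw [hlam, hnu, hind] at hS
  linarith

end Summit.CriticalPhenomena.PercolationContinuityZ3.Theorems.SahiGridPattern
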